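import Literature.MathematicalPhysics.QuantumFieldTheory.Balaban1983to89.Node00.AveragingSmooth
import Literature.MathematicalPhysics.QuantumFieldTheory.Balaban1983to89.LatticeWordStokes
import Summits.QuantumFields.YangMills.Theorems.UnitScaleTiltBlockAvgCorrector

/-!
# BalabanUVNodes ∕ N07 — CURVE-CRITICAL ⇒ TANGENT-CRITICAL AT THE ONE-SCALE PIN OF RECORD, WITH NO CHART HYPOTHESIS: the `k`-fold exact corrector of the
# averaging of record (general `SU(N)`), fibre curves with PRESCRIBED kernel velocity («corrector + o(t)»), and the N07 readings (module 35c of GAP-STATED(submersion))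

Cell `pub-ymgap`, seat `pub-ymgap-dag-n07-e` generation 14 (R141 (C), DAG node N07 = [15] = [Balaban1985Variational]; MODULE 35c; INBOX INTENT-35c).
`--kind proof --supports stmt-QuantumFields-20541` (K0⁷; count-neutral).  CONSUMED BY NAME, nothing modified: the route `UnitScaleTilt`'s ONE-STEP EXACT
CORRECTOR of Bałaban's (0.4) averaging with the printed exp-mean-log on `SU(N)` — `Summit.QuantumFields.YangMills.Theorems.BlockAvgCorrector.exists_avgFun_eq_of_near`
(p448916, cell `ym3-torus`; any torus `P`, private central bonds `BlockAveragingHaarAC.centralBond`, modulus `2η∕|I|⁻¹`) and its constants `stokesConst`,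
`emlWeight`; `LatticeWordStokes.small_of_plaqSmall`; this seat's 35a `Node00.CriticalOnFibreTangent` (`expChart`, velocities, `hasDerivAt_wilsonAction4_of_sameVelocity`,
`IsCritOnFibre` ∕ `IsCritOfRecord` bridge) and 35b-i `Node00.AveragingSmooth` (matrix extension `avgM` ∕ `iterM`, `coe_avgFun_of_small`, `contDiffAt_avgM_coeField`).

WHY.  35a reduced «criticality in the CURVE form ⇒ print's TANGENT form (82)» to the existence, for every kernel direction `X` of the linearised constraint, of a
curve INSIDE the fibre with velocity `U·X`.  For the ONE-SCALE pin of record `𝔅_k(V) = {U | Ū^k = V}` (g2 `IsCritOfRecord`; [15] (3),(5) p. 278) such curves come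
DIRECTLY from the tree's exact corrector, with no chart and no implicit-function theorem: if the matrix velocity of `t ↦ Ū^k(U·exp(tX))` vanishes at every
level-`k` bond, then `Ū^k(U·exp(tX))` is `o(t)`-close to `Ū^k(U)`, and the `k`-fold corrector (§1, iterating `exists_avgFun_eq_of_near` down the levels as the
route's SU(2) `exists_iter_eq_of_near` p518511 does) moves `U·exp(tX)` back INTO the fibre at a cost `≤ (2∕|I|⁻¹)^k·o(t) = o(t)` — the corrected curve keeps the
velocity `U·X` (§2).  Hence (§3): for `t₀`-small iterated averages (`stokesConst·t₀ < min(|I|⁻¹∕16, δ_N)`), CURVE-critical on `𝔅_k(Ū^k(U))` ⇒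
`d∕dt A(U·exp(tX))∣₀ = 0` for EVERY kernel direction `X` — GAP-STATED(submersion) (ref-C READ-121 NOTE 2, ref-G READ153 LABEL-NOTE (d)) DISCHARGED at the
one-scale pin, every `N`.

CONTENTS.  §1 ★ `exists_iter_eq_of_near_SU` (the `k`-fold exact corrector on `SU(N)`, guard `δ_N` as a hypothesis).  §2 `tendsto_coeField_iter_of_tendsto`,
`eventually_plaqSmall_iter_of_tendsto` (any family continuous at `0` in matrices), `tendsto_coeField_expChart_ray`, ★★ `exists_fibreCurve_of_kernel_velocity` (a curve `γ`, `γ 0 = U`, bond-wise velocity `U·X`, `Ū^k(γ t) = Ū^k(U)` near `0`).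
§3 ★★★ `hasDerivAt_wilsonAction4_expChart_of_isCritOnFibre_atScale`, `…_of_isCritOfRecord_of_small` (at NODE 00's objects, `avOfRecord F N K`).

HONEST FRAMING: count-neutral; calculus∕combinatorics about the tree's own averaging map, the analytic input being the route `UnitScaleTilt`'s corrector BY
NAME; nothing of [15]'s estimates; the MULTI-SCALE determining sets of V16 stub 1 (`genSet`) are NOT treated here (one-scale pin only); V16 stub 1 ∕ K0⁷ NOT
closed; N07 NOT discharged; counts unmoved (5∕27); one finite T⁴ programme at fixed ε — NOT continuum ∕ ℝ⁴ ∕ OS ∕ mass gap ∕ Clay.  No `sorry`, no `def`.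
-/

noncomputable section

open scoped Matrix.Norms.L2Operator Topology
open Filter Asymptotics Function NormedSpace

namespace Summit.QuantumFields.YangMills.BalabanUVNodes.N07CritTangentAtRecord

open Literature.MathematicalPhysics.QuantumFieldTheory.Balaban1983to89
open Literature.MathematicalPhysics.QuantumFieldTheory.Balaban1983to89.T4Continuum (T4Family)
open Literature.MathematicalPhysics.QuantumFieldTheory.Balaban1983to89.B15DeterminingSets
open Literature.MathematicalPhysics.QuantumFieldTheory.Balaban1983to89.BlockAveraging
open Literature.MathematicalPhysics.QuantumFieldTheory.Balaban1983to89.BlockAveragingHaarAC (centralBond)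
open Literature.MathematicalPhysics.QuantumFieldTheory.Balaban1983to89.BlockAveragingEMLHaarAC (emlWeight)
open Literature.MathematicalPhysics.QuantumFieldTheory.Balaban1983to89.ExpMeanLog (expMeanLogSU deltaSU deltaSU_pos)
open Literature.MathematicalPhysics.QuantumFieldTheory.Balaban1983to89.T4AdjointCovarianceUnitary (lieSU)
open Literature.MathematicalPhysics.QuantumFieldTheory.Balaban1983to89.Node00
open Summit.QuantumFields.YangMills.Theorems.BlockAvgCorrector (stokesConst stokesConst_nonneg emlWeight_pos emlWeight_le_one exists_avgFun_eq_of_near)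

/-! ## §1  The `k`-fold exact corrector of the (0.4) averaging on `SU(N)` -/

section Corrector

variable {P : Params} {N : ℕ} [NeZero N]

/-- One more averaging on top, for the (0.4) family on `SU(N)`: `Ū^{(n+1)} = avgFun ℰ (Ū^{(n)})` (definitional). [cite: Balaban1987RG1, (0.11) p.253 (bookkeeping)] -/
theorem iter_succ_eq_avgFun_rec (n : ℕ) (U : GaugeField P 0 (SU N)) :
    Averaging.iter (fun i => blockAvg (P := P) (j := i) (expMeanLogSU (n := Fin N))) (n + 1) U =
      avgFun (expMeanLogSU (n := Fin N)) (Averaging.iter (fun i => blockAvg (P := P) (j := i) (expMeanLogSU (n := Fin N))) n U) :=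
  rfl

/-- ★ **THE `k`-FOLD EXACT CORRECTOR ON `SU(N)`** (the route `UnitScaleTilt`'s one-step corrector `exists_avgFun_eq_of_near` iterated down the levels, as its SU(2)
`exists_iter_eq_of_near`; the guard `δ_N = min(1∕3, π∕N)` is a hypothesis): `t`-small iterated averages below `n ≤ m + K`, a level-`n` field `W` with
`‖W(c) − Ū^{(n)}(c)‖ ≤ η`, `stokesConst·t + (2∕|I|⁻¹)^n·η ≤ |I|⁻¹∕16` and `< δ_N` ⟹ `Ū′^{(n)} = W` exactly for some `U′` with `‖U′(b) − U(b)‖ ≤ (2∕|I|⁻¹)^n·η`.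
[cite: Balaban1987RG1, (0.4) p.253, (0.11) p.253; Balaban1985Variational, (47) p.285] -/
theorem exists_iter_eq_of_near_SU {t : ℝ} (ht : 0 ≤ t) :
    ∀ n : ℕ, n ≤ P.m + P.K →
    ∀ U : GaugeField P 0 (SU N),
      (∀ i, i < n → PlaqSmall t (Averaging.iter (fun i => blockAvg (P := P) (j := i) (expMeanLogSU (n := Fin N))) i U)) →
    ∀ (η : ℝ), 0 ≤ η → stokesConst P * t + (2 / emlWeight P) ^ n * η ≤ emlWeight P / 16 →
      stokesConst P * t + (2 / emlWeight P) ^ n * η < deltaSU (Fin N) →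
    ∀ W : GaugeField P n (SU N),
      (∀ c : PBond P n, ‖((W c : SU N) : Matrix (Fin N) (Fin N) ℂ) -
        ((Averaging.iter (fun i => blockAvg (P := P) (j := i) (expMeanLogSU (n := Fin N))) n U c : SU N) : Matrix (Fin N) (Fin N) ℂ)‖ ≤ η) →
    ∃ U' : GaugeField P 0 (SU N),
      Averaging.iter (fun i => blockAvg (P := P) (j := i) (expMeanLogSU (n := Fin N))) n U' = W ∧
      ∀ b : PBond P 0, ‖((U' b : SU N) : Matrix (Fin N) (Fin N) ℂ) - (U b : Matrix (Fin N) (Fin N) ℂ)‖ ≤ (2 / emlWeight P) ^ n * η := by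
  intro n
  induction n with
  | zero =>
    intro _ U _ η _ _ _ W hW
    refine ⟨W, rfl, fun b => ?_⟩
    rw [pow_zero, one_mul]
    exact hW b
  | succ n ih =>
    intro hn U hsm η hη hsmall hguard W hW
    have hκ : 0 < emlWeight P := emlWeight_pos P
    have hκ1 : emlWeight P ≤ 1 := emlWeight_le_one P
    have hst : 0 ≤ stokesConst P * t := mul_nonneg (stokesConst_nonneg P) ht
    have hq1 : 1 ≤ 2 / emlWeight P := by
      rw [le_div_iff₀ hκ]; linarith
    have hqn : 1 ≤ (2 / emlWeight P) ^ n := one_le_pow₀ hq1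
    have hpow : (2 / emlWeight P) ^ (n + 1) * η = (2 / emlWeight P) ^ n * (2 * η / emlWeight P) := by
      rw [pow_succ]; ring
    have h1 : 2 * η / emlWeight P ≤ (2 / emlWeight P) ^ (n + 1) * η := by
      rw [hpow]
      have : 0 ≤ 2 * η / emlWeight P := div_nonneg (by linarith) hκ.le
      nlinarith
    have hsmall₁ : stokesConst P * t + 2 * η / emlWeight P ≤ emlWeight P / 16 := by linarith
    have hguard₁ : stokesConst P * t + 2 * η / emlWeight P < (expMeanLogSU (n := Fin N)).δ := by
      show _ < deltaSU (Fin N)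
      linarith
    -- the level-`n` ambient field and the one-step corrector at the top
    have hΛsmall : PlaqSmall t (Averaging.iter (fun i => blockAvg (P := P) (j := i) (expMeanLogSU (n := Fin N))) n U) :=
      hsm n (Nat.lt_succ_self n)
    obtain ⟨μ, hμW, -, hμdist⟩ :=
      exists_avgFun_eq_of_near (n := Fin N) hn ht hη hsmall₁ hguard₁ _ hΛsmall W hW
    -- lift the new target all the way down (induction hypothesis with tolerance `2η|I|`)
    have hsmall' : stokesConst P * t + (2 / emlWeight P) ^ n * (2 * η / emlWeight P) ≤ emlWeight P / 16 := by rwa [← hpow]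
    have hguard' : stokesConst P * t + (2 / emlWeight P) ^ n * (2 * η / emlWeight P) < deltaSU (Fin N) := by rwa [← hpow]
    obtain ⟨U', hU'iter, hU'dist⟩ := ih (Nat.le_of_succ_le hn) U (fun i hi => hsm i (Nat.lt_succ_of_lt hi))
      (2 * η / emlWeight P) (div_nonneg (by linarith) hκ.le) hsmall' hguard' μ hμdist
    refine ⟨U', ?_, fun b => ?_⟩
    · rw [iter_succ_eq_avgFun_rec, hU'iter, hμW]
    · rw [hpow]; exact hU'dist b

end Corrector

/-! ## §2  Fibre curves with PRESCRIBED kernel velocity («corrector + o(t)») -/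

section Curve

variable {P : Params} {N : ℕ} [NeZero N]

/-- `PlaqSmall` is `PlaqSmallOn univ`. [cite: Balaban1987RG1, (0.18) p.255 (bookkeeping)] -/
theorem plaqSmall_iff_plaqSmallOn_univ {j : ℕ} {δ : ℝ} {U : GaugeField P j (SU N)} :
    PlaqSmall δ U ↔ PlaqSmallOn Set.univ δ U :=
  ⟨fun h p _ => h p, fun h p => h p (Set.mem_univ p)⟩

omit [NeZero N] in
/-- Continuity into the `SU(N)`-valued product from convergence of the bond matrices. [cite: Balaban1987RG1, (0.1) p.251 (bookkeeping)] -/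
theorem continuousAt_of_tendsto_coeField {j : ℕ} {Γ : ℝ → GaugeField P j (SU N)}
    (h : Tendsto (fun t => coeField (Γ t)) (𝓝 0) (𝓝 (coeField (Γ 0)))) :
    ContinuousAt (fun (t : ℝ) (b : PBond P j) => Γ t b) 0 := by
  rw [ContinuousAt, tendsto_pi_nhds]
  intro b
  rw [tendsto_subtype_rng]
  exact (tendsto_pi_nhds.1 h) b

/-- **THE ITERATED AVERAGES ALONG A FAMILY CONTINUOUS AT `0` IN MATRICES ARE CONTINUOUS AT `0` IN MATRICES**, provided the iterated averages of the base
field below level `i` are `t₀`-small with `stokesConst·t₀ < δ_N` (so they lie in the guard: 35b-i's `C^∞` matrix extension IS the averaging there, and stays so nearby).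
[cite: Balaban1987RG1, (0.4) p.253, (0.21) p.256] -/
theorem tendsto_coeField_iter_of_tendsto {t₀ : ℝ} (ht₀ : 0 < t₀) (hstδ : stokesConst P * t₀ < deltaSU (Fin N))
    {Γ : ℝ → GaugeField P 0 (SU N)} (hΓ : Tendsto (fun t => coeField (Γ t)) (𝓝 0) (𝓝 (coeField (Γ 0)))) :
    ∀ i : ℕ, (∀ i', i' < i → PlaqSmall t₀ (Averaging.iter (fun i => blockAvg (P := P) (j := i) (expMeanLogSU (n := Fin N))) i' (Γ 0))) →
      Tendsto (fun t : ℝ => coeField (Averaging.iter (fun i => blockAvg (P := P) (j := i) (expMeanLogSU (n := Fin N))) i (Γ t)))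
        (𝓝 0) (𝓝 (coeField (Averaging.iter (fun i => blockAvg (P := P) (j := i) (expMeanLogSU (n := Fin N))) i (Γ 0))))
  | 0, _ => hΓ
  | i + 1, hsm => by
    have ih := tendsto_coeField_iter_of_tendsto ht₀ hstδ hΓ i fun i' hi' => hsm i' (Nat.lt_succ_of_lt hi')
    -- the level-`i` family is continuous at `0` in `SU(N)^{bonds}`, hence eventually `t₀`-small, hence eventually in the guard
    have hcont : ContinuousAt (fun (t : ℝ) (b : PBond P i) => Averaging.iter (fun i => blockAvg (P := P) (j := i) (expMeanLogSU (n := Fin N))) i (Γ t) b) 0 :=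
      continuousAt_of_tendsto_coeField (Γ := fun t => Averaging.iter (fun i => blockAvg (P := P) (j := i) (expMeanLogSU (n := Fin N))) i (Γ t)) ih
    have hsmall0 : PlaqSmallOn Set.univ t₀ (Averaging.iter (fun i => blockAvg (P := P) (j := i) (expMeanLogSU (n := Fin N))) i (Γ 0)) :=
      plaqSmall_iff_plaqSmallOn_univ.1 (hsm i (Nat.lt_succ_self i))
    have hev : ∀ᶠ t in 𝓝 (0 : ℝ), ∀ c : PBond P (i + 1), Small (expMeanLogSU (n := Fin N)) (Averaging.iter (fun i => blockAvg (P := P) (j := i) (expMeanLogSU (n := Fin N))) i (Γ t)) c :=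
      (eventually_plaqSmallOn hcont hsmall0).mono fun t ht c =>
        LatticeWordStokes.small_of_plaqSmall (expMeanLogSU (n := Fin N)) ht₀.le (plaqSmall_iff_plaqSmallOn_univ.2 ht)
          (show stokesConst P * t₀ < deltaSU (Fin N) from hstδ) c
    -- on the guard the next average is the `C^∞` matrix extension of the previous one
    have hguard0 : ∀ c : PBond P (i + 1), Small (expMeanLogSU (n := Fin N)) (Averaging.iter (fun i => blockAvg (P := P) (j := i) (expMeanLogSU (n := Fin N))) i (Γ 0)) c :=
      fun c => LatticeWordStokes.small_of_plaqSmall (expMeanLogSU (n := Fin N)) ht₀.le (hsm i (Nat.lt_succ_self i))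
        (show stokesConst P * t₀ < deltaSU (Fin N) from hstδ) c
    have hA : ContinuousAt (avgM : (PBond P i → Matrix (Fin N) (Fin N) ℂ) → PBond P (i + 1) → Matrix (Fin N) (Fin N) ℂ)
        (coeField (Averaging.iter (fun i => blockAvg (P := P) (j := i) (expMeanLogSU (n := Fin N))) i (Γ 0))) :=
      (contDiffAt_avgM_coeField hguard0).continuousAt
    have hcomp := hA.tendsto.comp ih
    have heq : ∀ᶠ t in 𝓝 (0 : ℝ),
        (avgM ∘ fun t : ℝ => coeField (Averaging.iter (fun i => blockAvg (P := P) (j := i) (expMeanLogSU (n := Fin N))) i (Γ t))) t = coeField (Averaging.iter (fun i => blockAvg (P := P) (j := i) (expMeanLogSU (n := Fin N))) (i + 1) (Γ t)) :=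
      hev.mono fun t ht => by
        funext c
        show avgM _ c = ((avgFun (expMeanLogSU (n := Fin N)) _ c : SU N) : Matrix (Fin N) (Fin N) ℂ)
        rw [coe_avgFun_of_small _ c (ht c)]
    have hlim : avgM (coeField (Averaging.iter (fun i => blockAvg (P := P) (j := i) (expMeanLogSU (n := Fin N))) i (Γ 0))) = coeField (Averaging.iter (fun i => blockAvg (P := P) (j := i) (expMeanLogSU (n := Fin N))) (i + 1) (Γ 0)) := by
      funext c
      show avgM _ c = ((avgFun (expMeanLogSU (n := Fin N)) _ c : SU N) : Matrix (Fin N) (Fin N) ℂ)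
      rw [coe_avgFun_of_small _ c (hguard0 c)]
    rw [← hlim]
    exact Filter.Tendsto.congr' heq hcomp

/-- Along such a family the iterated averages below level `k` stay `t₀`-small for `t` near `0`. [cite: Balaban1987RG1, (0.4) p.253, (0.18) p.255] -/
theorem eventually_plaqSmall_iter_of_tendsto {t₀ : ℝ} (ht₀ : 0 < t₀) (hstδ : stokesConst P * t₀ < deltaSU (Fin N))
    {Γ : ℝ → GaugeField P 0 (SU N)} (hΓ : Tendsto (fun t => coeField (Γ t)) (𝓝 0) (𝓝 (coeField (Γ 0)))) {k : ℕ}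
    (hsm : ∀ i, i < k → PlaqSmall t₀ (Averaging.iter (fun i => blockAvg (P := P) (j := i) (expMeanLogSU (n := Fin N))) i (Γ 0))) :
    ∀ᶠ t in 𝓝 (0 : ℝ), ∀ i, i < k → PlaqSmall t₀ (Averaging.iter (fun i => blockAvg (P := P) (j := i) (expMeanLogSU (n := Fin N))) i (Γ t)) := by
  have hfin : ∀ i : Fin k, ∀ᶠ t in 𝓝 (0 : ℝ), PlaqSmall t₀ (Averaging.iter (fun i => blockAvg (P := P) (j := i) (expMeanLogSU (n := Fin N))) i (Γ t)) := by
    intro i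
    have ih := tendsto_coeField_iter_of_tendsto ht₀ hstδ hΓ i fun i' hi' => hsm i' (hi'.trans i.2)
    have hcont : ContinuousAt (fun (t : ℝ) (b : PBond P i) => Averaging.iter (fun i => blockAvg (P := P) (j := i) (expMeanLogSU (n := Fin N))) i (Γ t) b) 0 :=
      continuousAt_of_tendsto_coeField (Γ := fun t => Averaging.iter (fun i => blockAvg (P := P) (j := i) (expMeanLogSU (n := Fin N))) i (Γ t)) ih
    have hsmall0 : PlaqSmallOn Set.univ t₀ (Averaging.iter (fun i => blockAvg (P := P) (j := i) (expMeanLogSU (n := Fin N))) i (Γ 0)) := plaqSmall_iff_plaqSmallOn_univ.1 (hsm i i.2)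
    exact (eventually_plaqSmallOn hcont hsmall0).mono fun t ht => plaqSmall_iff_plaqSmallOn_univ.2 ht
  exact (eventually_all.2 hfin).mono fun t ht i hi => ht ⟨i, hi⟩

omit [NeZero N] in
/-- The ray `t ↦ U·exp(tX)` is continuous in matrices, with base `U`. [cite: Balaban1985RegularSpaces, (1.10) p.77 (bookkeeping)] -/
theorem tendsto_coeField_expChart_ray (U : GaugeField P 0 (SU N)) (X : PBond P 0 → lieSU (Fin N)) :
    Tendsto (fun t : ℝ => coeField (expChart U (t • X))) (𝓝 0) (𝓝 (coeField ((fun t : ℝ => expChart U (t • X)) 0))) := by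
  have hc : Continuous fun t : ℝ => coeField (expChart U (t • X)) :=
    ((contDiff_coeField_expChart U).comp (contDiff_id.smul contDiff_const)).continuous
  exact hc.tendsto 0

/-- ★★ **FIBRE CURVES WITH PRESCRIBED KERNEL VELOCITY.**  On a torus `P`, at a level `k ≤ m + K`, let `U` have `t₀`-small iterated averages `Ū^{(i)}`, `i < k`,
with `stokesConst·t₀ < |I|⁻¹∕16` and `< δ_N`, and let `X : bonds → 𝔰𝔲(N)` be a KERNEL DIRECTION of the linearised `k`-fold averaging at `U`: the matrix velocity
at `t = 0` of `t ↦ Ū^{(k)}(U·exp(tX))(c)` is `0` at every level-`k` bond `c`.  Then there is a curve `γ` with `γ 0 = U`, bond-wise matrix velocity `U_b·X_b` at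
`0`, and `Ū^{(k)}(γ t) = Ū^{(k)}(U)` for `t` near `0` — a curve IN THE FIBRE `𝔅_k(Ū^k(U))` with velocity `U·X`.  Construction: the `k`-fold corrector (§1)
applied to `U·exp(tX)` with target `Ū^k(U)` and defect `η(t) = Σ_c ‖Ū^k(U·exp(tX))(c) − Ū^k(U)(c)‖ = o(t)`; the correction is `≤ (2∕|I|⁻¹)^k·η(t) = o(t)`.
[cite: Balaban1985Variational, (3),(5) p.278, Sect. C (47) p.285, Prop. 3 p.289, (82)–(83) p.290; Balaban1987RG1, (0.4), (0.11) p.253] -/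
theorem exists_fibreCurve_of_kernel_velocity {t₀ : ℝ} (ht₀ : 0 < t₀) (hst : stokesConst P * t₀ < emlWeight P / 16)
    (hstδ : stokesConst P * t₀ < deltaSU (Fin N)) {k : ℕ} (hk : k ≤ P.m + P.K) {U : GaugeField P 0 (SU N)}
    (hsm : ∀ i, i < k → PlaqSmall t₀ (Averaging.iter (fun i => blockAvg (P := P) (j := i) (expMeanLogSU (n := Fin N))) i U))
    {X : PBond P 0 → lieSU (Fin N)}
    (hX : ∀ c : PBond P k, HasDerivAt
      (fun t : ℝ => ((Averaging.iter (fun i => blockAvg (P := P) (j := i) (expMeanLogSU (n := Fin N))) k (expChart U (t • X)) c : SU N) :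
        Matrix (Fin N) (Fin N) ℂ)) 0 0) :
    ∃ γ : ℝ → GaugeField P 0 (SU N), γ 0 = U ∧
      (∀ b : PBond P 0, HasDerivAt (fun t => ((γ t b : SU N) : Matrix (Fin N) (Fin N) ℂ))
        ((U b : Matrix (Fin N) (Fin N) ℂ) * (X b : Matrix (Fin N) (Fin N) ℂ)) 0) ∧
      ∀ᶠ t in 𝓝 (0 : ℝ), Averaging.iter (fun i => blockAvg (P := P) (j := i) (expMeanLogSU (n := Fin N))) k (γ t) =
        Averaging.iter (fun i => blockAvg (P := P) (j := i) (expMeanLogSU (n := Fin N))) k U := by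
  classical
  -- notation-free abbreviations
  set av : ∀ j, Averaging P j (SU N) := fun i => blockAvg (P := P) (j := i) (expMeanLogSU (n := Fin N)) with hav
  set Γ₀ : ℝ → GaugeField P 0 (SU N) := fun t => expChart U (t • X) with hΓ₀
  have hΓ₀0 : Γ₀ 0 = U := by simp only [hΓ₀, zero_smul, expChart_zero]
  -- the defect `η(t) = Σ_c ‖Ū^k(Γ₀ t)(c) − Ū^k(U)(c)‖`, an `o(t)`
  set η : ℝ → ℝ := fun t => ∑ c : PBond P k,
    ‖((Averaging.iter av k (Γ₀ t) c : SU N) : Matrix (Fin N) (Fin N) ℂ) - ((Averaging.iter av k U c : SU N) : Matrix (Fin N) (Fin N) ℂ)‖ with hη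
  have hη_nonneg : ∀ t, 0 ≤ η t := fun t => Finset.sum_nonneg fun c _ => norm_nonneg _
  have hη0 : η 0 = 0 := by
    simp only [hη, hΓ₀0, sub_self, norm_zero, Finset.sum_const_zero]
  have hterm : ∀ c : PBond P k, (fun t : ℝ => ((Averaging.iter av k (Γ₀ t) c : SU N) : Matrix (Fin N) (Fin N) ℂ) -
      ((Averaging.iter av k U c : SU N) : Matrix (Fin N) (Fin N) ℂ)) =o[𝓝 0] fun t => t := by
    intro c
    have h := hasDerivAt_iff_isLittleO.1 (hX c)
    simp only [sub_zero, smul_zero, zero_smul, expChart_zero] at h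
    exact h
  have hηo : η =o[𝓝 0] fun t => t := by
    have hsum := IsLittleO.sum (s := (Finset.univ : Finset (PBond P k))) fun c _ => (hterm c).norm_left
    refine hsum.congr_left fun t => ?_
    simp only [hη]
  have hη_tendsto : Tendsto η (𝓝 0) (𝓝 0) := hηo.trans_tendsto tendsto_id
  -- constants
  have hκ : 0 < emlWeight P := emlWeight_pos P
  set q : ℝ := (2 / emlWeight P) ^ k with hq
  have hq0 : 0 ≤ q := pow_nonneg (div_nonneg (by norm_num) hκ.le) k
  -- the good set: base smallness, and the two quantitative conditions of the corrector
  have hgood : ∀ᶠ t in 𝓝 (0 : ℝ), (∀ i, i < k → PlaqSmall t₀ (Averaging.iter av i (Γ₀ t))) ∧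
      stokesConst P * t₀ + q * η t ≤ emlWeight P / 16 ∧ stokesConst P * t₀ + q * η t < deltaSU (Fin N) := by
    have hlin : Tendsto (fun t => stokesConst P * t₀ + q * η t) (𝓝 0) (𝓝 (stokesConst P * t₀ + q * 0)) :=
      tendsto_const_nhds.add (tendsto_const_nhds.mul hη_tendsto)
    rw [mul_zero, add_zero] at hlin
    have hray := eventually_plaqSmall_iter_of_tendsto ht₀ hstδ (tendsto_coeField_expChart_ray U X) (k := k)
      (by intro i hi; rw [zero_smul, expChart_zero]; exact hsm i hi)
    refine hray.and ((hlin.eventually (eventually_le_nhds hst)).and (hlin.eventually (eventually_lt_nhds hstδ)))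
  -- the corrected curve
  have hcorr : ∀ t, (∀ i, i < k → PlaqSmall t₀ (Averaging.iter av i (Γ₀ t))) →
      stokesConst P * t₀ + q * η t ≤ emlWeight P / 16 → stokesConst P * t₀ + q * η t < deltaSU (Fin N) →
      ∃ U' : GaugeField P 0 (SU N), Averaging.iter av k U' = Averaging.iter av k U ∧
        ∀ b, ‖((U' b : SU N) : Matrix (Fin N) (Fin N) ℂ) - (Γ₀ t b : Matrix (Fin N) (Fin N) ℂ)‖ ≤ q * η t := by
    intro t h1 h2 h3
    refine exists_iter_eq_of_near_SU ht₀.le k hk (Γ₀ t) h1 (η t) (hη_nonneg t) h2 h3 (Averaging.iter av k U) fun c => ?_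
    rw [norm_sub_rev]
    exact Finset.single_le_sum (f := fun c => ‖((Averaging.iter av k (Γ₀ t) c : SU N) : Matrix (Fin N) (Fin N) ℂ) -
      ((Averaging.iter av k U c : SU N) : Matrix (Fin N) (Fin N) ℂ)‖) (fun c _ => norm_nonneg _) (Finset.mem_univ c)
  set γ : ℝ → GaugeField P 0 (SU N) := fun t =>
    if h : (∀ i, i < k → PlaqSmall t₀ (Averaging.iter av i (Γ₀ t))) ∧
        stokesConst P * t₀ + q * η t ≤ emlWeight P / 16 ∧ stokesConst P * t₀ + q * η t < deltaSU (Fin N)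
    then Classical.choose (hcorr t h.1 h.2.1 h.2.2) else U with hγdef
  have hγ_spec : ∀ t, ∀ h : (∀ i, i < k → PlaqSmall t₀ (Averaging.iter av i (Γ₀ t))) ∧
      stokesConst P * t₀ + q * η t ≤ emlWeight P / 16 ∧ stokesConst P * t₀ + q * η t < deltaSU (Fin N),
      Averaging.iter av k (γ t) = Averaging.iter av k U ∧
        ∀ b, ‖((γ t b : SU N) : Matrix (Fin N) (Fin N) ℂ) - (Γ₀ t b : Matrix (Fin N) (Fin N) ℂ)‖ ≤ q * η t := by
    intro t h
    have hγt : γ t = Classical.choose (hcorr t h.1 h.2.1 h.2.2) := by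
      rw [hγdef]
      exact dif_pos h
    rw [hγt]
    exact Classical.choose_spec (hcorr t h.1 h.2.1 h.2.2)
  have hgood0 : (∀ i, i < k → PlaqSmall t₀ (Averaging.iter av i (Γ₀ 0))) ∧
      stokesConst P * t₀ + q * η 0 ≤ emlWeight P / 16 ∧ stokesConst P * t₀ + q * η 0 < deltaSU (Fin N) := by
    refine ⟨fun i hi => by rw [hΓ₀0]; exact hsm i hi, ?_, ?_⟩
    · rw [hη0, mul_zero, add_zero]; exact hst.le
    · rw [hη0, mul_zero, add_zero]; exact hstδ
  have hγ0 : γ 0 = U := by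
    obtain ⟨-, hdist⟩ := hγ_spec 0 hgood0
    funext b
    apply Subtype.ext
    have hb := hdist b
    rw [hη0, mul_zero] at hb
    have hb' : ((γ 0 b : SU N) : Matrix (Fin N) (Fin N) ℂ) = (Γ₀ 0 b : Matrix (Fin N) (Fin N) ℂ) :=
      sub_eq_zero.1 (norm_le_zero_iff.1 hb)
    rw [hb', hΓ₀0]
  refine ⟨γ, hγ0, fun b => ?_, ?_⟩
  · -- velocity: `γ = Γ₀ + o(t)` bond-wise
    have hΓ₀b : HasDerivAt (fun t => ((Γ₀ t b : SU N) : Matrix (Fin N) (Fin N) ℂ))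
        ((U b : Matrix (Fin N) (Fin N) ℂ) * (X b : Matrix (Fin N) (Fin N) ℂ)) 0 :=
      hasDerivAt_coe_expChart_along (U := U) (c := fun t : ℝ => t • X) (hasDerivAt_ray X) (zero_smul ℝ X) b
    have hdiff : (fun t => ((γ t b : SU N) : Matrix (Fin N) (Fin N) ℂ) - (Γ₀ t b : Matrix (Fin N) (Fin N) ℂ)) =o[𝓝 0] fun t => t := by
      have hbig : (fun t => ((γ t b : SU N) : Matrix (Fin N) (Fin N) ℂ) - (Γ₀ t b : Matrix (Fin N) (Fin N) ℂ)) =O[𝓝 0] η := by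
        refine IsBigO.of_bound q (hgood.mono fun t ht => ?_)
        rw [Real.norm_of_nonneg (hη_nonneg t)]
        exact (hγ_spec t ht).2 b
      exact hbig.trans_isLittleO hηo
    rw [hasDerivAt_iff_isLittleO] at hΓ₀b ⊢
    simp only [sub_zero] at hΓ₀b ⊢
    have hsum := hΓ₀b.add hdiff
    refine hsum.congr_left fun t => ?_
    rw [hγ0, hΓ₀0]
    abel
  · exact hgood.mono fun t ht => (hγ_spec t ht).1

end Curve

/-! ## §3  The N07 readings: CURVE-critical ⇒ TANGENT-critical at the one-scale pin, no chart hypothesis -/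

section Record

variable {F : T4Family} {N : ℕ} [NeZero N]

/-- ★★★ **CURVE-CRITICAL ⇒ TANGENT-CRITICAL AT THE ONE-SCALE PIN OF RECORD, EVERY `N`, NO CHART HYPOTHESIS.**  At NODE 00's objects (torus `F.P K`, the averaging
of record), at a level `k ≤ m + K`, let `U` have `t₀`-small iterated averages `Ū^i`, `i < k` (`stokesConst·t₀ < |I|⁻¹∕16` and `< δ_N`), and let `U` be a critical
configuration of (5) on the fibre of the one-scale determining set `atScale k` through it (datum `W` with `W k = Ū^k(U)`) in the CURVE form (`IsCritOnFibre`).  Then for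
every kernel direction `X` of the linearised `k`-fold averaging at `U` (velocity form), `d∕dt A(U·exp(tX))∣_{t=0} = 0` — print's (82) on (83).
[cite: Balaban1985Variational, (3),(5) p.278, (82)–(83) p.290, (141) p.299, p.300, Prop. 8 p.304; Balaban1987RG1, (0.4), (0.11) p.253] -/
theorem hasDerivAt_wilsonAction4_expChart_of_isCritOnFibre_atScale {K k : ℕ} (hk : k ≤ (F.P K).m + (F.P K).K) {t₀ : ℝ} (ht₀ : 0 < t₀)
    (hst : stokesConst (F.P K) * t₀ < emlWeight (F.P K) / 16) (hstδ : stokesConst (F.P K) * t₀ < deltaSU (Fin N))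
    {U : GaugeField (F.P K) 0 (SU N)} (hsm : ∀ i, i < k → PlaqSmall t₀ (avgFamily (avOfRecord F N K) U i))
    {W : MSField (F.P K) (SU N)} (hW : W k = avgFamily (avOfRecord F N K) U k) (hcrit : IsCritOnFibre F N K (atScale k) W U)
    {X : PBond (F.P K) 0 → lieSU (Fin N)}
    (hX : ∀ c : PBond (F.P K) k, HasDerivAt
      (fun t : ℝ => ((avgFamily (avOfRecord F N K) (expChart U (t • X)) k c : SU N) : Matrix (Fin N) (Fin N) ℂ)) 0 0) :
    HasDerivAt (fun t : ℝ => wilsonAction4 (expChart U (t • X))) 0 0 := by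
  obtain ⟨γ, hγ0, hγvel, hγfib⟩ := exists_fibreCurve_of_kernel_velocity (P := F.P K) ht₀ hst hstδ hk (U := U) hsm (X := X) hX
  have h₂ : ∀ b, HasDerivAt (fun t : ℝ => ((expChart U (t • X) b : SU N) : Matrix (Fin N) (Fin N) ℂ))
      ((U b : Matrix (Fin N) (Fin N) ℂ) * (X b : Matrix (Fin N) (Fin N) ℂ)) 0 :=
    hasDerivAt_coe_expChart_along (U := U) (c := fun t : ℝ => t • X) (hasDerivAt_ray X) (zero_smul ℝ X)
  have h12 : γ 0 = (fun t : ℝ => expChart U (t • X)) 0 := by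
    show γ 0 = expChart U ((0 : ℝ) • X)
    rw [hγ0, zero_smul, expChart_zero]
  have hfib : ∀ᶠ t in 𝓝 (0 : ℝ), AgreeOn (atScale k) (avgFamily (avOfRecord F N K) (γ t)) W :=
    hγfib.mono fun t ht => (agreeOn_atScale_iff k _ _).2 (by rw [hW]; exact ht)
  have hd : DifferentiableAt ℝ (fun (t : ℝ) (b : PBond (F.P K) 0) => ((γ t b : SU N) : Matrix (Fin N) (Fin N) ℂ)) 0 :=
    (hasDerivAt_pi.2 hγvel).differentiableAt
  have ha := hasDerivAt_wilsonAction4 hγvel (fun p => hasDerivAt_coe_plaqHol hγvel p)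
  have ha0 := hcrit γ hγ0 hd hfib _ ha
  rw [ha0] at ha
  exact hasDerivAt_wilsonAction4_of_sameVelocity h12 hγvel h₂ ha

/-- ★★★ **THE SAME FOR THIS SEAT'S g2 PIN `IsCritOfRecord F N K k V U`** («critical configuration of (5) on 𝔅_k(V)», no holes): with `V = Ū^k(U)` and `t₀`-small iterated
averages, curve-criticality gives `d∕dt A(U·exp(tX))∣₀ = 0` for every kernel direction `X`. [cite: Balaban1985Variational, (3),(5) p.278, (82)–(83) p.290, (141) p.299, p.300] -/
theorem hasDerivAt_wilsonAction4_expChart_of_isCritOfRecord_of_small {K k : ℕ} (hk : k ≤ (F.P K).m + (F.P K).K) {t₀ : ℝ} (ht₀ : 0 < t₀)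
    (hst : stokesConst (F.P K) * t₀ < emlWeight (F.P K) / 16) (hstδ : stokesConst (F.P K) * t₀ < deltaSU (Fin N))
    {U : GaugeField (F.P K) 0 (SU N)} (hsm : ∀ i, i < k → PlaqSmall t₀ (avgFamily (avOfRecord F N K) U i))
    (hcrit : IsCritOfRecord F N K k (avgFamily (avOfRecord F N K) U k) U)
    {X : PBond (F.P K) 0 → lieSU (Fin N)}
    (hX : ∀ c : PBond (F.P K) k, HasDerivAt
      (fun t : ℝ => ((avgFamily (avOfRecord F N K) (expChart U (t • X)) k c : SU N) : Matrix (Fin N) (Fin N) ℂ)) 0 0) :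
    HasDerivAt (fun t : ℝ => wilsonAction4 (expChart U (t • X))) 0 0 :=
  hasDerivAt_wilsonAction4_expChart_of_isCritOnFibre_atScale hk ht₀ hst hstδ hsm (W := avgFamily (avOfRecord F N K) U) rfl
    ((isCritOnFibre_atScale_iff k _ U).2 hcrit) hX

/-- The conclusion as the vanishing of the plain derivative. [cite: Balaban1985Variational, (82) p.290 (bookkeeping)] -/
theorem deriv_wilsonAction4_expChart_eq_zero_of_isCritOfRecord_of_small {K k : ℕ} (hk : k ≤ (F.P K).m + (F.P K).K) {t₀ : ℝ} (ht₀ : 0 < t₀)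
    (hst : stokesConst (F.P K) * t₀ < emlWeight (F.P K) / 16) (hstδ : stokesConst (F.P K) * t₀ < deltaSU (Fin N))
    {U : GaugeField (F.P K) 0 (SU N)} (hsm : ∀ i, i < k → PlaqSmall t₀ (avgFamily (avOfRecord F N K) U i))
    (hcrit : IsCritOfRecord F N K k (avgFamily (avOfRecord F N K) U k) U)
    {X : PBond (F.P K) 0 → lieSU (Fin N)}
    (hX : ∀ c : PBond (F.P K) k, HasDerivAt
      (fun t : ℝ => ((avgFamily (avOfRecord F N K) (expChart U (t • X)) k c : SU N) : Matrix (Fin N) (Fin N) ℂ)) 0 0) :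
    deriv (fun t : ℝ => wilsonAction4 (expChart U (t • X))) 0 = 0 :=
  (hasDerivAt_wilsonAction4_expChart_of_isCritOfRecord_of_small hk ht₀ hst hstδ hsm hcrit hX).deriv

end Record

end Summit.QuantumFields.YangMills.BalabanUVNodes.N07CritTangentAtRecord

end
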